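import Summits.BirchSwinnertonDyer.Rank1Residual.X11b.BDPRouteHalvesClass
import HarnessLib

/-!
# Class X11b, route "BDP + converse-theorem engine + Kolyvagin": the unconditional upper half as a per-pair lever (cell `b2b-bsdres`, sub-cell `multr1-p2`, gen 3)

HONEST FRAMING (cell `b2b-bsdres`, run/shared/lean/b2b/bsd-rank1-residual/, verbatim in every
file): the goal of the cell is to DELETE the COMBINATION-SHAPED residual classes of the
Birch–Swinnerton-Dyer formula for ALL analytic-rank `≤ 1` elliptic curves over `ℚ` — "full BSD
formula for every rank `≤ 1` curve in class `C`" assembled STRICTLY from published theorems — so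
that the rank-`≤ 1` remainder becomes exactly the CONSTRUCTION-SHAPED classes, which are TYPED
(missing-input `Prop`s), NOT attempted. This is not "finishing BSD". Sub-cell `multr1-p2` is a
RESEARCH ROUTE on class X11b (`ClassX11b W p := r_an = 1 ∧ p ≠ 2 ∧ mult(p) ∧ irr(p)`,
`Partition/Rows.lean`); no claim beyond the stated class and locus; X11b's label does not change;
NOTHING is booked by this file (admissibility of a per-pair closure is the referee's ruling).

THEOREMS ONLY (no definition, no named fact). `X11b/BDPRouteHalvesClass.lean` proves, from TEN
PUBLISHED named facts of the tree and NO typed input, the Euler-system half of `BSD(E,p)` on the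
route's `Locus`: `missingUpperBoundAt_of_classX11b_of_locus` — for `(E,p)` in X11b with `p ≥ 5`, a
(ram) prime and `p ∤ ∏_ℓ c_ℓ(E)`, `ord_p #Ш(E) ≤ ord_p #Ш(E)_an`. This file spells out its two
per-pair uses:

* `padicValNat_shaOrder_le_of_classX11b_of_locus` — the numeric form: whatever rational `q` equals
  `#Ш(E)_an`, `ord_p #Ш(E) ≤ ord_p q` (so a pair with `#Ш(E)_an = p^{2k}·u`, `p ∤ u`, has
  `ord_p #Ш(E) ≤ 2k` with NO Heegner-index computation — cf. the cell's use of a computed Kolyvagin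
  index bound for 403280bd1 at `p = 5`, `X11b/VisibilityPair403280bd1.lean`);
* `bsdp_of_classX11b_of_locus_of_padicValRat_shaAn_le` — the certificate case: if `#Ш(E)_an = q`
  with `ord_p q ≤ 0`, then `BSD(E,p)` — from published facts alone. Compared with the cell's
  Kolyvagin certificate (`Typed.bsdp_of_kolyvagin_of_not_dvd_index`: a Heegner field with
  `p ∤ [E(K):ℤy_K]`), the index may here be divisible by `p` (the `p`-part of `[E(K):ℤP]²` equals
  that of `#Ш(E)_an · #Ш(E^{d_K})_an · (∏c_ℓ)²` by `exists_shaAn_padicVal_eq_of_heegner` + Skinner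
  2016 Thm. C, and the twist's `Ш` is absorbed by Skinner's theorem), at the price of the `Locus`
  hypotheses (ram) and `p ∤ ∏_ℓ c_ℓ(E)`. How `ord_p #Ш(E)_an` is certified for a rank-one pair
  (two-engine Heegner index + the twist's modular-symbol value, or otherwise) is lane business.

References: [JetchevSkinnerWan2017] §7.4.2 (p. 31); [Skinner2016PacificMC] Thm. C;
[McCallumLMS1991] §1; [Miller2011LMS] Def. 1.1; [GrossLMS1991] Prop. 2.1 (2).
-/

noncomputable section

open scoped Classical

open WeierstrassCurve NumberField Literature.NumberTheory.EllipticCurves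
  Literature.NumberTheory.EllipticCurves.ModularForms
  Literature.NumberTheory.EllipticCurves.Rank1Residual

namespace Summit.BirchSwinnertonDyer.Rank1Residual.X11b

/-- **Numeric form of the unconditional upper half on `Locus`.** From the ten PUBLISHED named
facts (`hGZ` … `hNS`, as in `missingUpperBoundAt_of_classX11b_of_locus`): for every `(E,p)` in
X11b with `p ≥ 5`, a (ram) prime and `p ∤ ∏_ℓ c_ℓ(E)`, and every rational `q` with
`#Ш(E)_an = q`: `ord_p #Ш(E) ≤ ord_p q` (the rational value of `#Ш(E)_an` is unique). NO typed
input; nothing booked. [cite: JetchevSkinnerWan2017, §7.4.2 (p. 31)]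
[cite: McCallumLMS1991, §1 Theorem (Kolyvagin), p. 296] [cite: Miller2011LMS, Def. 1.1] -/
theorem padicValNat_shaOrder_le_of_classX11b_of_locus
    -- published inputs (named facts of the tree)
    (hGZ : ∀ (N : ℕ) [NeZero N] (W : WeierstrassCurve ℚ) (K : Type) [Field K] [NumberField K],
      gross_zagier N W K)
    (hKo : ∀ (N : ℕ) [NeZero N] (W : WeierstrassCurve ℚ) (K : Type) [Field K] [NumberField K],
      kolyvagin N W K)
    (hB : ∀ (N : ℕ) [NeZero N] (W : WeierstrassCurve ℚ) (K : Type) [Field K] [NumberField K],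
      Kolyvagin1990_padicValNat_card_sha_le N W K)
    (hSk : Skinner2016.thmC_padicValRat_bsd_rank_zero)
    (hGZK : rank_eq_analyticRank_of_analyticRank_le_one) (hmod : hasEntireLFunction_rat)
    (hnf : exists_isNewformOf)
    (hFH : friedbergHoffstein_exists_heegnerField_split_twist_ne_zero)
    (hMaz : mazur_not_dvd_maninConstant_of_odd) (hNS : integral_neronScaling_of_isGloballyMinimal)
    (W : WeierstrassCurve ℚ) [W.IsElliptic] [W.IsGloballyMinimal] (p : ℕ) [Fact p.Prime]
    (hX : ClassX11b W p) (hloc : Locus W p) {q : ℚ} (hq : shaAn W = (q : ℂ)) :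
    (padicValNat p W.shaOrder : ℤ) ≤ padicValRat p q := by
  obtain ⟨q', hq', hle⟩ :=
    missingUpperBoundAt_of_classX11b_of_locus hGZ hKo hB hSk hGZK hmod hnf hFH hMaz hNS W p hX hloc
  have hqq : q' = q := by exact_mod_cast hq'.symm.trans hq
  exact hqq ▸ hle

/-- **The certificate case of the unconditional upper half: `ord_p #Ш(E)_an ≤ 0` ⇒ `BSD(E,p)` on
`Locus`, from published facts alone.** For `(E,p)` in X11b with `p ≥ 5`, a (ram) prime,
`p ∤ ∏_ℓ c_ℓ(E)`, and `#Ш(E)_an = q` with `ord_p q ≤ 0` (a certified value; how it is certified is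
lane business): the upper half gives `ord_p #Ш(E) ≤ 0`, so `ord_p #Ш(E) = 0 ≥ ord_p q`, which is
the lower half for free; `bsdp_of_halves`. Unlike the Kolyvagin certificate
(`Typed.bsdp_of_kolyvagin_of_not_dvd_index`), the Heegner index used internally may be divisible
by `p` (its `p`-part is carried by `#Ш(E^{d_K})`, absorbed by Skinner 2016 Thm. C). NO typed input;
NOTHING booked here (referee's ruling). [cite: JetchevSkinnerWan2017, §7.4.2 (p. 31)]
[cite: GrossLMS1991, §2 Prop. 2.1 (2)] [cite: Miller2011LMS, Def. 1.1] -/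
theorem bsdp_of_classX11b_of_locus_of_padicValRat_shaAn_le
    -- published inputs (named facts of the tree)
    (hGZ : ∀ (N : ℕ) [NeZero N] (W : WeierstrassCurve ℚ) (K : Type) [Field K] [NumberField K],
      gross_zagier N W K)
    (hKo : ∀ (N : ℕ) [NeZero N] (W : WeierstrassCurve ℚ) (K : Type) [Field K] [NumberField K],
      kolyvagin N W K)
    (hB : ∀ (N : ℕ) [NeZero N] (W : WeierstrassCurve ℚ) (K : Type) [Field K] [NumberField K],
      Kolyvagin1990_padicValNat_card_sha_le N W K)
    (hSk : Skinner2016.thmC_padicValRat_bsd_rank_zero)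
    (hGZK : rank_eq_analyticRank_of_analyticRank_le_one) (hmod : hasEntireLFunction_rat)
    (hnf : exists_isNewformOf)
    (hFH : friedbergHoffstein_exists_heegnerField_split_twist_ne_zero)
    (hMaz : mazur_not_dvd_maninConstant_of_odd) (hNS : integral_neronScaling_of_isGloballyMinimal)
    (W : WeierstrassCurve ℚ) [W.IsElliptic] [W.IsGloballyMinimal] (p : ℕ) [Fact p.Prime]
    (hX : ClassX11b W p) (hloc : Locus W p) {q : ℚ} (hq : shaAn W = (q : ℂ))
    (hv : padicValRat p q ≤ 0) : BSDp W p := by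
  have hup :=
    padicValNat_shaOrder_le_of_classX11b_of_locus hGZ hKo hB hSk hGZK hmod hnf hFH hMaz hNS W p hX
      hloc hq
  have hlow : Typed.MissingLowerBoundAt W p := ⟨q, hq, by omega⟩
  exact bsdp_of_halves hGZK W p (le_of_eq hX.1) hlow ⟨q, hq, hup⟩

/-- **The residue of the atom "X11b ∧ (ram) ∧ `p ∣ ∏c_ℓ`" on route p2, typed.** For `(E,p)` in
X11b with `p ≥ 5` and a (ram) prime (ANY Tamagawa numbers): STEP L (`hL`, the route's typed input at
the Manin-good Heegner data of such pairs) gives the main-conjecture half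
(`missingLowerBoundAt_of_classX11b_of_ram`), so `BSD(E,p)` follows from STEP L together with the
Euler-system half `Typed.MissingUpperBoundAt W p` ALONE — on `Locus` the latter is the theorem
`missingUpperBoundAt_of_classX11b_of_locus`; off `Locus` (`p ∣ ∏c_ℓ(E)`) it is Kolyvagin's bound
sharpened by the Tamagawa numbers, in print only under `p ∤ N` (Jetchev 2008 Cor. 1.5) or through
the Shimura-curve parametrisation of Jetchev–Skinner–Wan 2017 Thm. 4.4.1 / §7.4.2 (not in the
tree). CONDITIONAL (STEP L + the typed upper half); nothing booked; X11b's label unchanged.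
[cite: JetchevSkinnerWan2017, §7.4.1–7.4.2 (pp. 30–31) and Thm. 4.4.1] [cite: Jetchev2008, Cor. 1.5 (p. 3)]
[cite: Miller2011LMS, Def. 1.1] -/
theorem bsdp_of_classX11b_of_ram_of_missingUpperBoundAt
    -- published inputs (named facts of the tree)
    (hGZ : ∀ (N : ℕ) [NeZero N] (W : WeierstrassCurve ℚ) (K : Type) [Field K] [NumberField K],
      gross_zagier N W K)
    (hKo : ∀ (N : ℕ) [NeZero N] (W : WeierstrassCurve ℚ) (K : Type) [Field K] [NumberField K],
      kolyvagin N W K)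
    (hSk : Skinner2016.thmC_padicValRat_bsd_rank_zero)
    (hGZK : rank_eq_analyticRank_of_analyticRank_le_one) (hmod : hasEntireLFunction_rat)
    (hnf : exists_isNewformOf)
    (hFH : friedbergHoffstein_exists_heegnerField_split_twist_ne_zero)
    (hMaz : mazur_not_dvd_maninConstant_of_odd) (hNS : integral_neronScaling_of_isGloballyMinimal)
    -- the typed input of the route (STEP L), at every Heegner datum with Manin constant prime to `p`
    (hL : ∀ (W : WeierstrassCurve ℚ) [W.IsElliptic] [W.IsGloballyMinimal] (p : ℕ) [Fact p.Prime]
      (N : ℕ) [NeZero N] (K : Type) [Field K] [NumberField K]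
      (Dt : ModularParametrizationData W N) (H : HeegnerDatum N (NumberField.discr K)) (ι : K →+* ℂ)
      (P : (W.baseChange K).toAffine.Point),
      ClassX11b W p → 5 ≤ p → Ram W p → W.conductorNorm ℤ = N → IsImaginaryQuadratic K →
      SatisfiesHeegnerHypothesis N K →
      WeierstrassCurve.Affine.Point.map ι.toRatAlgHom P = heegnerPointComplex Dt H →
      ¬ (p : ℤ) ∣ Dt.c → IndexLowerBoundAt W p K P)
    (W : WeierstrassCurve ℚ) [W.IsElliptic] [W.IsGloballyMinimal] (p : ℕ) [Fact p.Prime]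
    (hX : ClassX11b W p) (hp5 : 5 ≤ p) (hram : Ram W p)
    -- the Euler-system half at the pair (typed)
    (hU : Typed.MissingUpperBoundAt W p) : BSDp W p :=
  bsdp_of_halves hGZK W p (le_of_eq hX.1)
    (missingLowerBoundAt_of_classX11b_of_ram hGZ hKo hSk hGZK hmod hnf hFH hMaz hNS hL W p hX hp5 hram)
    hU

end Summit.BirchSwinnertonDyer.Rank1Residual.X11b

end
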